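import Literature.NumberTheory.LFunctions.Zhang2022.DHMenuConsistentFence

/-!
# Zhang (2022), rung F-S3, family B-dh — world lemma W7 (counting): the zeros of `W(D, χ)` in the critical strip up to
# height `T` form an explicit finite set, and `stripCount = 2·⌊(F_f(T)+1)/2⌋₊` (`+ 2` on the exceptional slots)

Y. Zhang, *Discrete mean estimates and the Landau–Siegel zero*, arXiv:2211.02515v1 [Zhang2022LandauSiegel] — an unrefereed
manuscript under adjudication. **The programme SEARCHES and TYPES; no claim about Landau–Siegel zeros, Theorems 1–2 of
arXiv:2211.02515 or a repaired Margin232 until a kernel theorem says so.** Bookkeeping over the cell's consistency world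
`DH.world D χ` (p461081/p461386); nothing about an actual `L`-function. Cell `landau-siegel`, sub-cell E, stub S-E-p4-5, row13b
(and the count input of rows 04/S2) of B-dh/SIGMA-E-HANDOVER.md v1 85415a87d174988f: «(W7) finiteness: `{ρ ∈ fence f | |ρ.im| ≤ T}`
is finite and has `2·#{n ≥ 1 : γ_n(f) ≤ T} = 2⌊(F_f(T)+1)/2⌋₊` elements … `stripCount q ψ T = 2⌊(F+1)/2⌋₊ (+2 on the slot (D,χ))`».

## Contents (`f := ψ.conductor ≥ 1` at positive level; `N := fenceCount f T = ⌊(F_f(T)+1)/2⌋₊`; `T ≥ 0`)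

* `fenceBelow f N` — the explicit `Finset` `{½ ± iγ_{n+1}(f) : n < N}`; `card_fenceBelow` (`= 2N`: the two half-fences are
  disjoint and `n ↦ γ_{n+1}` is injective, `DHMenuConsistentFence`); `mem_fenceBelow_iff` (`↔ ρ ∈ fence f ∧ |Im ρ| ≤ T` at
  `N = fenceCount f T`, by `fenceOrdinate_le_iff_le_count`).
* `stripSet_world_of_not_exc` / `stripSet_world_of_exc` — the set `{ρ : zero of the slot, 0 < Re ρ < 1, |Im ρ| ≤ T}` IS
  `fenceBelow f N` (non-exceptional slot), resp. `fenceBelow f N ∪ {β₁, 1 − β₁}` (exceptional slot; `log D ≥ 43250`).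
* **`stripCount_world_of_not_exc : stripCount = 2·N`**, **`stripCount_world_of_exc : stripCount = 2·N + 2`** — every zero
  is simple (`isZero_world_iff_mult_eq_one`), so the weighted `finsum` is a cardinality.

References as in `DHChainBarrier` ([BennettMartinOBryantRechnitzer2021] Thm 1.1 for the counting function `N(T, χ)`).
-/

noncomputable section

open scoped Classical
open Complex Set

namespace Literature.NumberTheory.LFunctions.Zhang2022.DH

/-! ### The finite fence below a height -/

/-- The fence points `½ ± iγ_{n+1}(f)`, `n < N`, as a `Finset`. [cite: BennettMartinOBryantRechnitzer2021, Theorem 1.1] -/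
def fenceBelow (f N : ℕ) : Finset ℂ :=
  (Finset.range N).image (fun n : ℕ => (1 / 2 : ℂ) + ((fenceOrdinate f (n + 1) : ℝ) : ℂ) * I) ∪
    (Finset.range N).image (fun n : ℕ => (1 / 2 : ℂ) - ((fenceOrdinate f (n + 1) : ℝ) : ℂ) * I)

/-- Imaginary parts of the two half-fence points. [cite: BennettMartinOBryantRechnitzer2021, Theorem 1.1] -/
private theorem im_half_add (γ : ℝ) :
    ((1 / 2 : ℂ) + (γ : ℂ) * I).im = γ ∧ ((1 / 2 : ℂ) - (γ : ℂ) * I).im = -γ := by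
  constructor <;> simp

/-- **`#fenceBelow f N = 2N`** (`f ≥ 1`): the upper and lower half-fences are disjoint and each is indexed injectively.
[cite: BennettMartinOBryantRechnitzer2021, Theorem 1.1] -/
theorem card_fenceBelow {f : ℕ} (hf : 1 ≤ f) (N : ℕ) : (fenceBelow f N).card = 2 * N := by
  have hpos : ∀ n : ℕ, 0 < fenceOrdinate f (n + 1) := fun n => fenceOrdinate_pos hf (Nat.succ_le_succ (Nat.zero_le n))
  have hinj := fenceOrdinate_succ_injective hf
  have inj1 : Function.Injective (fun n : ℕ => (1 / 2 : ℂ) + ((fenceOrdinate f (n + 1) : ℝ) : ℂ) * I) := by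
    intro n m h
    have := congrArg Complex.im h
    simp only [(im_half_add _).1] at this
    exact hinj this
  have inj2 : Function.Injective (fun n : ℕ => (1 / 2 : ℂ) - ((fenceOrdinate f (n + 1) : ℝ) : ℂ) * I) := by
    intro n m h
    have := congrArg Complex.im h
    simp only [(im_half_add _).2, neg_inj] at this
    exact hinj this
  have hdisj : Disjoint ((Finset.range N).image (fun n : ℕ => (1 / 2 : ℂ) + ((fenceOrdinate f (n + 1) : ℝ) : ℂ) * I))
      ((Finset.range N).image (fun n : ℕ => (1 / 2 : ℂ) - ((fenceOrdinate f (n + 1) : ℝ) : ℂ) * I)) := by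
    rw [Finset.disjoint_left]
    intro ρ h1 h2
    obtain ⟨n, -, rfl⟩ := Finset.mem_image.1 h1
    obtain ⟨m, -, hm⟩ := Finset.mem_image.1 h2
    have := congrArg Complex.im hm
    simp only [(im_half_add _).1, (im_half_add _).2] at this
    linarith [hpos n, hpos m]
  unfold fenceBelow
  rw [Finset.card_union_of_disjoint hdisj, Finset.card_image_of_injective _ inj1,
    Finset.card_image_of_injective _ inj2, Finset.card_range]
  ring

/-- **`fenceBelow f (fenceCount f T)` is exactly the fence below height `T`**: `ρ ∈ fence f ∧ |Im ρ| ≤ T` (`f ≥ 1`, `T ≥ 0`).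
[cite: BennettMartinOBryantRechnitzer2021, Theorem 1.1] -/
theorem mem_fenceBelow_iff {f : ℕ} (hf : 1 ≤ f) {T : ℝ} (hT : 0 ≤ T) {ρ : ℂ} :
    ρ ∈ fenceBelow f (fenceCount f T) ↔ ρ ∈ fence f ∧ |ρ.im| ≤ T := by
  have hpos : ∀ n : ℕ, 0 < fenceOrdinate f (n + 1) := fun n => fenceOrdinate_pos hf (Nat.succ_le_succ (Nat.zero_le n))
  have key : ∀ n : ℕ, n < fenceCount f T ↔ fenceOrdinate f (n + 1) ≤ T := by
    intro n
    rw [fenceOrdinate_le_iff_le_count hf (Nat.succ_le_succ (Nat.zero_le n)) hT]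
    omega
  unfold fenceBelow
  simp only [Finset.mem_union, Finset.mem_image, Finset.mem_range]
  constructor
  · rintro (⟨n, hn, rfl⟩ | ⟨n, hn, rfl⟩)
    · refine ⟨mem_fence_iff.2 (Or.inl ⟨n, rfl⟩), ?_⟩
      rw [(im_half_add _).1, abs_of_pos (hpos n)]; exact (key n).1 hn
    · refine ⟨mem_fence_iff.2 (Or.inr ⟨n, rfl⟩), ?_⟩
      rw [(im_half_add _).2, abs_neg, abs_of_pos (hpos n)]; exact (key n).1 hn
  · rintro ⟨hρ, him⟩
    rcases mem_fence_iff.1 hρ with ⟨n, rfl⟩ | ⟨n, rfl⟩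
    · rw [(im_half_add _).1, abs_of_pos (hpos n)] at him
      exact Or.inl ⟨n, (key n).2 him, rfl⟩
    · rw [(im_half_add _).2, abs_neg, abs_of_pos (hpos n)] at him
      exact Or.inr ⟨n, (key n).2 him, rfl⟩

/-- The conductor of a character of positive level is `≥ 1`. [folklore] -/
private theorem one_le_conductor' {q : ℕ} [NeZero q] (ψ : DirichletCharacter ℂ q) : 1 ≤ ψ.conductor :=
  Nat.one_le_iff_ne_zero.2 (DirichletCharacter.conductor_ne_zero ψ)

/-! ### The strip set of a slot of `W(D, χ)` -/

/-- **Non-exceptional slot**: the zeros with `0 < Re ρ < 1`, `|Im ρ| ≤ T` are exactly the fence below `T`.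
[cite: BennettMartinOBryantRechnitzer2021, Theorem 1.1] -/
theorem stripSet_world_of_not_exc {D : ℕ} (χ : DirichletCharacter ℂ D) {q : ℕ} [NeZero q] {ψ : DirichletCharacter ℂ q}
    (hψ : ¬ IsExcSlot D χ q ψ) {T : ℝ} (hT : 0 ≤ T) :
    {ρ : ℂ | (world D χ).IsZero q ψ ρ ∧ 0 < ρ.re ∧ ρ.re < 1 ∧ |ρ.im| ≤ T} =
      ↑(fenceBelow ψ.conductor (fenceCount ψ.conductor T)) := by
  ext ρ
  rw [Finset.mem_coe, mem_fenceBelow_iff (one_le_conductor' ψ) hT, Set.mem_setOf_eq, isZero_world_iff]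
  constructor
  · rintro ⟨hz | ⟨hexc, -⟩, -, -, him⟩
    · exact ⟨hz, him⟩
    · exact absurd hexc hψ
  · rintro ⟨hz, him⟩
    have hre := fence_re hz
    exact ⟨Or.inl hz, by rw [hre]; norm_num, by rw [hre]; norm_num, him⟩

/-- **Exceptional slot** (`log D ≥ 43250`): the same set is the fence below `T` together with the pair `β₁, 1 − β₁`.
[cite: BennettMartinOBryantRechnitzer2021, Theorem 1.1] -/
theorem stripSet_world_of_exc {D : ℕ} {χ : DirichletCharacter ℂ D} (hL : (43250 : ℝ) ≤ Real.log D) {q : ℕ} [NeZero q]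
    {ψ : DirichletCharacter ℂ q} (hψ : IsExcSlot D χ q ψ) {T : ℝ} (hT : 0 ≤ T) :
    {ρ : ℂ | (world D χ).IsZero q ψ ρ ∧ 0 < ρ.re ∧ ρ.re < 1 ∧ |ρ.im| ≤ T} =
      ↑(fenceBelow ψ.conductor (fenceCount ψ.conductor T) ∪ {((betaExc D : ℝ) : ℂ), ((1 - betaExc D : ℝ) : ℂ)}) := by
  have hb1 := half_lt_betaExc hL
  have hb2 := (betaExc_window hL).2
  have hb3 := one_sub_betaExc_lt_half hL
  ext ρ
  rw [Finset.coe_union, Set.mem_union, Finset.mem_coe, mem_fenceBelow_iff (one_le_conductor' ψ) hT, Finset.coe_insert,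
    Finset.coe_singleton, Set.mem_setOf_eq, isZero_world_iff]
  constructor
  · rintro ⟨hz | ⟨-, hpair⟩, -, -, him⟩
    · exact Or.inl ⟨hz, him⟩
    · exact Or.inr (by simpa [excPair] using hpair)
  · rintro (⟨hz, him⟩ | hpair)
    · have hre := fence_re hz
      exact ⟨Or.inl hz, by rw [hre]; norm_num, by rw [hre]; norm_num, him⟩
    · have hpair' : ρ ∈ excPair D := by simpa [excPair] using hpair
      refine ⟨Or.inr ⟨hψ, hpair'⟩, ?_, ?_, ?_⟩
      · rcases re_of_mem_excPair hpair' with h | h <;> rw [h] <;> linarith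
      · rcases re_of_mem_excPair hpair' with h | h <;> rw [h] <;> linarith
      · rw [im_of_mem_excPair hpair', abs_zero]; exact hT

/-! ### `stripCount` of `W(D, χ)` -/

/-- On a zero of `W` the weight `mult` is `1` (simple zeros). [cite: Zhang2022LandauSiegel, §2 Assumption (A)] -/
private theorem sum_mult_eq_card {D : ℕ} (χ : DirichletCharacter ℂ D) {q : ℕ} [NeZero q] (ψ : DirichletCharacter ℂ q)
    (s : Finset ℂ) (hs : ∀ ρ ∈ s, (world D χ).IsZero q ψ ρ) : ∑ ρ ∈ s, (world D χ).mult q ψ ρ = s.card := by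
  rw [Finset.card_eq_sum_ones]
  exact Finset.sum_congr rfl fun ρ hρ => (isZero_world_iff_mult_eq_one χ).1 (hs ρ hρ)

/-- **`stripCount` on a non-exceptional slot: `2·⌊(F_f(T)+1)/2⌋₊`** (`f = conductor ψ`, `T ≥ 0`).
[cite: BennettMartinOBryantRechnitzer2021, Theorem 1.1] -/
theorem stripCount_world_of_not_exc {D : ℕ} (χ : DirichletCharacter ℂ D) {q : ℕ} [NeZero q] {ψ : DirichletCharacter ℂ q}
    (hψ : ¬ IsExcSlot D χ q ψ) {T : ℝ} (hT : 0 ≤ T) :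
    (world D χ).stripCount q ψ T = 2 * fenceCount ψ.conductor T := by
  unfold ZeroWorld.stripCount
  rw [stripSet_world_of_not_exc χ hψ hT, finsum_mem_coe_finset, sum_mult_eq_card χ ψ, card_fenceBelow (one_le_conductor' ψ)]
  intro ρ hρ
  exact isZero_world_iff.2 (Or.inl ((mem_fenceBelow_iff (one_le_conductor' ψ) hT).1 hρ).1)

/-- **`stripCount` on an exceptional slot: `2·⌊(F_f(T)+1)/2⌋₊ + 2`** (`f = conductor ψ`, `T ≥ 0`, `log D ≥ 43250`): the fence
plus the simple real pair `β₁, 1 − β₁`. [cite: BennettMartinOBryantRechnitzer2021, Theorem 1.1] -/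
theorem stripCount_world_of_exc {D : ℕ} {χ : DirichletCharacter ℂ D} (hL : (43250 : ℝ) ≤ Real.log D) {q : ℕ} [NeZero q]
    {ψ : DirichletCharacter ℂ q} (hψ : IsExcSlot D χ q ψ) {T : ℝ} (hT : 0 ≤ T) :
    (world D χ).stripCount q ψ T = 2 * fenceCount ψ.conductor T + 2 := by
  have hc := one_le_conductor' ψ
  have hb1 := half_lt_betaExc hL
  have hb3 := one_sub_betaExc_lt_half hL
  -- the pair is not on the fence (it is real) and consists of two distinct points
  have hne : ((betaExc D : ℝ) : ℂ) ≠ ((1 - betaExc D : ℝ) : ℂ) := by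
    intro h; have := Complex.ofReal_inj.1 h; linarith
  have hdisj : Disjoint (fenceBelow ψ.conductor (fenceCount ψ.conductor T))
      {((betaExc D : ℝ) : ℂ), ((1 - betaExc D : ℝ) : ℂ)} := by
    rw [Finset.disjoint_left]
    intro ρ h1 h2
    have hf := ((mem_fenceBelow_iff hc hT).1 h1).1
    have hp : ρ ∈ excPair D := by simpa [excPair] using h2
    exact not_mem_excPair_of_mem_fence hc hf hp
  unfold ZeroWorld.stripCount
  rw [stripSet_world_of_exc hL hψ hT, finsum_mem_coe_finset, sum_mult_eq_card χ ψ, Finset.card_union_of_disjoint hdisj,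
    card_fenceBelow hc, Finset.card_pair hne]
  intro ρ hρ
  rcases Finset.mem_union.1 hρ with h | h
  · exact isZero_world_iff.2 (Or.inl ((mem_fenceBelow_iff hc hT).1 h).1)
  · exact isZero_world_iff.2 (Or.inr ⟨hψ, by simpa [excPair] using h⟩)

end Literature.NumberTheory.LFunctions.Zhang2022.DH
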